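import Mathlib
import HarnessLib

/-!
# Route `F4SubCurvatureDoor`, crux `SubCurvatureKernel` ⟨stmt-QuantumFields-23036⟩ — soft half, input (C) «continuity off 0»,
# part 4: the LAPLACE–FOURIER TRANSFORM OF A TEST FUNCTION vanishes at infinity; Fubini; continuity of Laplace–Fourier evaluations

Helper file (`--supports stmt-QuantumFields-23036 --as helper`; free-hands seat `ym-line-frs-p2` g18).  Pure analysis on `ℝ × ℝ³`,
kernel-generic; definition-free, 0 sorry, standard axioms.  No item is closed; no summit, no crux and no mass gap is proved by this file.

WHAT.  With the (cut-off) Laplace–Fourier integrand `G x p := exp(min(E,0) − t₊ E₊) · cos⟪q, z⃗⟫` for `x = (t, z⃗)`, `p = (E, q)` in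
`ℝ × ℝ³` (`|G| ≤ 1`; for `t > 0`, `E ≥ 0` it is `e^{−tE} cos⟪q, z⃗⟫`):
* ★ `exists_lfTest` — for a continuous compactly supported `χ` with support in `{t > 0}`, the transform
  `Φ p := ∫ χ(x) G x p dx` is a bounded continuous function on `ℝ × ℝ³` VANISHING AT INFINITY: decay in `E → +∞` from `t ≥ t₁ > 0` on the
  support, in `E → −∞` from the cut-off `e^{min(E,0)}`, and in `|q| → ∞` by the half-period Riemann–Lebesgue trick
  (`2Φ(p) = ∫ (χ(x) − χ(x + (0, πq/|q|²))) G x p dx` and uniform continuity of `χ`);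
* `integral_lfTest_eq` — Fubini: `∫ Φ dν = ∫ χ(x) (∫ G x p dν(p)) dx` for every finite measure `ν`;
* `continuous_lfEval` — `x ↦ ∫ G x p dν(p)` is continuous for every finite measure `ν` (dominated convergence).

WHY.  Step (ii) of input (C) (HOME INBOX owner g23 16:54:59Z): these are the test functions against which the vague cluster point of the
tilted Laplace–Fourier measures of the mollified kernels (✓`exists_laplaceFourier_mollified`, ✓`exists_finiteMeasure_mapClusterPt`) is
identified with the kernel `K` on a half-space (next file).

HONEST LABEL: analytic plumbing toward input (C) of the SOFT half of ⟨23036⟩; the SUB-CURVATURE clause is the crux, untouched; ⟨23036⟩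
is an open problem; the Yang–Mills mass gap is NOT proved; no summit is proved by a line.
-/

set_option autoImplicit false

noncomputable section

open scoped Topology NNReal ENNReal BoundedContinuousFunction InnerProductSpace
open MeasureTheory Filter Set Function Metric

namespace Summit.QuantumFields.YangMills.Theorems.F4SubCurvatureDoorSubCurvatureKernelLFTest

/-! ## §1 The integrand -/

/-- `|exp(min(E,0) − t₊E₊) cos⟪q, z⃗⟫| ≤ 1`. [bookkeeping] -/
theorem abs_lfIntegrand_le_one (x p : ℝ × EuclideanSpace ℝ (Fin 3)) :
    |Real.exp (min p.1 0 - max x.1 0 * max p.1 0) * Real.cos ⟪p.2, x.2⟫_ℝ| ≤ 1 := by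
  rw [abs_mul, Real.abs_exp]
  have h1 : Real.exp (min p.1 0 - max x.1 0 * max p.1 0) ≤ 1 := by
    rw [Real.exp_le_one_iff]
    have : 0 ≤ max x.1 0 * max p.1 0 := mul_nonneg (le_max_right _ _) (le_max_right _ _)
    linarith [min_le_right p.1 0]
  exact mul_le_one₀ h1 (abs_nonneg _) (Real.abs_cos_le_one _)

/-- The integrand is continuous in both variables jointly. [bookkeeping] -/
theorem continuous_lfIntegrand :
    Continuous fun y : (ℝ × EuclideanSpace ℝ (Fin 3)) × (ℝ × EuclideanSpace ℝ (Fin 3)) =>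
      Real.exp (min y.2.1 0 - max y.1.1 0 * max y.2.1 0) * Real.cos ⟪y.2.2, y.1.2⟫_ℝ := by
  fun_prop

/-! ## §2 Continuity of Laplace–Fourier evaluations of a finite measure -/

/-- **Laplace–Fourier evaluations of a finite measure are jointly continuous** in `x = (t, z⃗)` (dominated convergence, `|G| ≤ 1`).
[folklore] -/
theorem continuous_lfEval (ν : Measure (ℝ × EuclideanSpace ℝ (Fin 3))) [IsFiniteMeasure ν] :
    Continuous fun x : ℝ × EuclideanSpace ℝ (Fin 3) =>
      ∫ p, Real.exp (min p.1 0 - max x.1 0 * max p.1 0) * Real.cos ⟪p.2, x.2⟫_ℝ ∂ν := by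
  refine continuous_of_dominated (bound := fun _ => 1) (fun x => ?_) (fun x => Eventually.of_forall fun p => ?_)
    (integrable_const _) (Eventually.of_forall fun p => ?_)
  · exact (continuous_lfIntegrand.comp (Continuous.prodMk_right x)).aestronglyMeasurable
  · rw [Real.norm_eq_abs]; exact abs_lfIntegrand_le_one x p
  · exact continuous_lfIntegrand.comp (Continuous.prodMk_left p)

/-! ## §3 Fubini -/

/-- **Fubini for the transform of a test function against a finite measure**:
`∫ (∫ χ(x) G x p dx) dν(p) = ∫ χ(x) (∫ G x p dν(p)) dx`. [folklore] -/
theorem integral_lfTest_eq (χ : ℝ × EuclideanSpace ℝ (Fin 3) → ℝ) (hχ : Continuous χ) (hχc : HasCompactSupport χ)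
    (ν : Measure (ℝ × EuclideanSpace ℝ (Fin 3))) [IsFiniteMeasure ν] :
    ∫ p, (∫ x, χ x * (Real.exp (min p.1 0 - max x.1 0 * max p.1 0) * Real.cos ⟪p.2, x.2⟫_ℝ)) ∂ν =
      ∫ x, χ x * ∫ p, Real.exp (min p.1 0 - max x.1 0 * max p.1 0) * Real.cos ⟪p.2, x.2⟫_ℝ ∂ν := by
  have hχi : Integrable χ := hχ.integrable_of_hasCompactSupport hχc
  have hI : Integrable (uncurry fun (p : ℝ × EuclideanSpace ℝ (Fin 3)) (x : ℝ × EuclideanSpace ℝ (Fin 3)) =>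
      χ x * (Real.exp (min p.1 0 - max x.1 0 * max p.1 0) * Real.cos ⟪p.2, x.2⟫_ℝ)) (ν.prod volume) := by
    have hdom : Integrable (fun y : (ℝ × EuclideanSpace ℝ (Fin 3)) × (ℝ × EuclideanSpace ℝ (Fin 3)) => (1 : ℝ) * ‖χ y.2‖)
        (ν.prod volume) := (integrable_const (1 : ℝ)).mul_prod hχi.norm
    refine hdom.mono' ?_ (Eventually.of_forall fun y => ?_)
    · exact ((hχ.comp continuous_snd).mul (continuous_lfIntegrand.comp continuous_swap)).aestronglyMeasurable
    · simp only [uncurry]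
      rw [norm_mul, one_mul]
      refine mul_le_of_le_one_right (norm_nonneg _) ?_
      rw [Real.norm_eq_abs]; exact abs_lfIntegrand_le_one y.2 y.1
  rw [integral_integral_swap hI]
  refine integral_congr_ae (Eventually.of_forall fun x => ?_)
  beta_reduce
  rw [integral_const_mul]

/-! ## §4 ★ The transform of a positive-time test function vanishes at infinity -/

/-- ★ **The Laplace–Fourier transform of a positive-time test function is a bounded continuous function vanishing at infinity.**
[folklore; the half-period argument is the classical proof of the Riemann–Lebesgue lemma] -/
theorem exists_lfTest (χ : ℝ × EuclideanSpace ℝ (Fin 3) → ℝ) (hχ : Continuous χ) (hχc : HasCompactSupport χ)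
    (hχs : tsupport χ ⊆ Ioi 0 ×ˢ univ) :
    ∃ Φ : ℝ × EuclideanSpace ℝ (Fin 3) →ᵇ ℝ,
      (∀ p, Φ p = ∫ x, χ x * (Real.exp (min p.1 0 - max x.1 0 * max p.1 0) * Real.cos ⟪p.2, x.2⟫_ℝ)) ∧
      Tendsto Φ (cocompact _) (𝓝 0) := by
  have hχi : Integrable χ := hχ.integrable_of_hasCompactSupport hχc
  set I : ℝ := ∫ x, |χ x| with hI
  have hI0 : 0 ≤ I := integral_nonneg fun x => abs_nonneg _
  set G : (ℝ × EuclideanSpace ℝ (Fin 3)) → (ℝ × EuclideanSpace ℝ (Fin 3)) → ℝ :=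
    fun x p => Real.exp (min p.1 0 - max x.1 0 * max p.1 0) * Real.cos ⟪p.2, x.2⟫_ℝ with hG
  have hG1 : ∀ x p, |G x p| ≤ 1 := fun x p => abs_lfIntegrand_le_one x p
  set Φf : ℝ × EuclideanSpace ℝ (Fin 3) → ℝ := fun p => ∫ x, χ x * G x p with hΦf
  -- continuity and the global bound `|Φ| ≤ I`
  have hΦc : Continuous Φf := by
    refine continuous_of_dominated (bound := fun x => |χ x|) (fun p => ?_) (fun p => Eventually.of_forall fun x => ?_)
      hχi.abs (Eventually.of_forall fun x => ?_)
    · exact (hχ.mul (continuous_lfIntegrand.comp (Continuous.prodMk_left p))).aestronglyMeasurable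
    · rw [Real.norm_eq_abs, abs_mul]; exact mul_le_of_le_one_right (abs_nonneg _) (hG1 x p)
    · exact continuous_const.mul (continuous_lfIntegrand.comp (Continuous.prodMk_right x))
  have hΦ_le : ∀ (p) (e : ℝ), (∀ x, χ x ≠ 0 → |G x p| ≤ e) → 0 ≤ e → |Φf p| ≤ e * I := by
    intro p e he he0
    simp only [hΦf]
    calc |∫ x, χ x * G x p| ≤ ∫ x, |χ x * G x p| := abs_integral_le_integral_abs
      _ ≤ ∫ x, e * |χ x| := by
          refine integral_mono_of_nonneg (Eventually.of_forall fun x => abs_nonneg _) (hχi.abs.const_mul e)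
            (Eventually.of_forall fun x => ?_)
          beta_reduce
          by_cases hx : χ x = 0
          · simp [hx]
          · rw [abs_mul, mul_comm]; exact mul_le_mul_of_nonneg_right (he x hx) (abs_nonneg _)
      _ = e * I := integral_const_mul _ _
  have hΦb : ∀ p, ‖Φf p‖ ≤ I := fun p => by
    rw [Real.norm_eq_abs]; simpa using hΦ_le p 1 (fun x _ => hG1 x p) zero_le_one
  set Φ : ℝ × EuclideanSpace ℝ (Fin 3) →ᵇ ℝ := BoundedContinuousFunction.ofNormedAddCommGroup Φf hΦc I hΦb with hΦ
  refine ⟨Φ, fun p => rfl, ?_⟩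
  -- a lower bound `t₁ > 0` of the time on the support
  obtain ⟨t₁, ht₁, hsupp⟩ : ∃ t₁ : ℝ, 0 < t₁ ∧ ∀ x, χ x ≠ 0 → t₁ ≤ x.1 := by
    rcases (tsupport χ).eq_empty_or_nonempty with h | h
    · refine ⟨1, one_pos, fun x hx => ?_⟩
      have : x ∈ tsupport χ := subset_tsupport _ hx
      rw [h] at this; exact absurd this (notMem_empty _)
    · obtain ⟨x₀, hx₀, hmin⟩ := hχc.isCompact.exists_isMinOn h continuous_fst.continuousOn
      refine ⟨x₀.1, (hχs hx₀).1, fun x hx => hmin (subset_tsupport _ hx)⟩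
  -- decay in `E`
  have hE : ∀ p, |Φf p| ≤ Real.exp (min p.1 0 - t₁ * max p.1 0) * I := by
    intro p
    refine hΦ_le p _ (fun x hx => ?_) (Real.exp_pos _).le
    simp only [hG]
    rw [abs_mul, Real.abs_exp]
    refine (mul_le_of_le_one_right (Real.exp_pos _).le (Real.abs_cos_le_one _)).trans ?_
    rw [Real.exp_le_exp]
    have h1 : t₁ ≤ max x.1 0 := (hsupp x hx).trans (le_max_left _ _)
    nlinarith [le_max_right p.1 0]
  -- decay in `q`: the half-period bound
  have huc : UniformContinuous χ := hχc.uniformContinuous_of_continuous hχ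
  obtain ⟨R₀, hR₀⟩ : ∃ R₀ : ℝ, tsupport χ ⊆ closedBall 0 R₀ := hχc.isCompact.isBounded.subset_closedBall 0
  set V : ℝ := (volume (closedBall (0 : ℝ × EuclideanSpace ℝ (Fin 3)) (R₀ + 1))).toReal with hV
  haveI : (volume : Measure (ℝ × EuclideanSpace ℝ (Fin 3))).IsAddRightInvariant := by
    rw [show (volume : Measure (ℝ × EuclideanSpace ℝ (Fin 3))) = (volume : Measure ℝ).prod volume from rfl]
    infer_instance
  have hq : ∀ η : ℝ, 0 < η → ∀ δ : ℝ, 0 < δ → δ ≤ 1 → (∀ x y, dist x y < δ → dist (χ x) (χ y) < η) →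
      ∀ p : ℝ × EuclideanSpace ℝ (Fin 3), Real.pi / δ < ‖p.2‖ → |Φf p| ≤ η * V / 2 := by
    intro η hη δ hδ hδ1 hmod p hp
    have hq0 : 0 < ‖p.2‖ := lt_trans (by positivity) hp
    have hqne : p.2 ≠ 0 := norm_pos_iff.1 hq0
    -- the half period `d`
    set d : EuclideanSpace ℝ (Fin 3) := (Real.pi / ‖p.2‖ ^ 2) • p.2 with hd
    have hqd : ⟪p.2, d⟫_ℝ = Real.pi := by
      rw [hd, real_inner_smul_right, real_inner_self_eq_norm_sq]; field_simp
    have hdn : ‖d‖ = Real.pi / ‖p.2‖ := by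
      rw [hd, norm_smul, Real.norm_eq_abs, abs_of_pos (by positivity)]; field_simp
    have hdδ : ‖d‖ < δ := by
      rw [hdn, div_lt_iff₀ hq0]; rw [div_lt_iff₀ hδ] at hp; linarith
    set v : ℝ × EuclideanSpace ℝ (Fin 3) := (0, d) with hv
    have hvn : ‖v‖ < δ := by
      rw [hv, Prod.norm_def, norm_zero, max_eq_right (norm_nonneg _)]; exact hdδ
    -- `G (x + v) p = - G x p`
    have hGv : ∀ x, G (x + v) p = -G x p := by
      intro x
      simp only [hG, hv, Prod.snd_add, Prod.fst_add, add_zero, inner_add_right, hqd, Real.cos_add_pi]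
      ring
    -- integrability
    have hi1 : Integrable (fun x => χ x * G x p) := by
      refine hχi.abs.mono' (hχ.mul (continuous_lfIntegrand.comp (Continuous.prodMk_left p))).aestronglyMeasurable
        (Eventually.of_forall fun x => ?_)
      rw [Real.norm_eq_abs, abs_mul]; exact mul_le_of_le_one_right (abs_nonneg _) (hG1 x p)
    have hi2 : Integrable (fun x => χ (x + v) * G x p) := by
      have h := (hi1.comp_add_right v).neg
      refine h.congr (Eventually.of_forall fun x => ?_)
      show -(χ (x + v) * G (x + v) p) = χ (x + v) * G x p
      rw [hGv]; ring
    -- `2 Φ p = ∫ (χ x - χ (x + v)) G x p`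
    have hA : Φf p = -∫ x, χ (x + v) * G x p := by
      have hshift : ∫ x, χ (x + v) * G (x + v) p = ∫ x, χ x * G x p :=
        integral_add_right_eq_self (μ := (volume : Measure (ℝ × EuclideanSpace ℝ (Fin 3)))) (fun x => χ x * G x p) v
      simp only [hΦf]
      rw [← hshift, ← integral_neg]
      refine integral_congr_ae (Eventually.of_forall fun x => ?_)
      beta_reduce; rw [hGv]; ring
    have hB : Φf p = ∫ x, χ x * G x p := rfl
    have h2 : 2 * Φf p = ∫ x, (χ x - χ (x + v)) * G x p := by
      have : 2 * Φf p = (∫ x, χ x * G x p) - ∫ x, χ (x + v) * G x p := by linarith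
      rw [this, ← integral_sub hi1 hi2]
      refine integral_congr_ae (Eventually.of_forall fun x => ?_)
      beta_reduce; ring
    -- the pointwise bound `|χ x - χ (x + v)| |G| ≤ η 𝟙_{B(0, R₀ + 1)}`
    have hpt : ∀ x, |(χ x - χ (x + v)) * G x p| ≤ (closedBall (0 : ℝ × EuclideanSpace ℝ (Fin 3)) (R₀ + 1)).indicator
        (fun _ => η) x := by
      intro x
      by_cases hx : χ x = 0 ∧ χ (x + v) = 0
      · rw [hx.1, hx.2, sub_zero, zero_mul, abs_zero]; exact Set.indicator_nonneg (fun _ _ => hη.le) _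
      · have hmem : x ∈ closedBall (0 : ℝ × EuclideanSpace ℝ (Fin 3)) (R₀ + 1) := by
          rw [mem_closedBall, dist_zero_right]
          rcases not_and_or.1 hx with h | h
          · have := hR₀ (subset_tsupport _ h); rw [mem_closedBall, dist_zero_right] at this; linarith
          · have := hR₀ (subset_tsupport _ h); rw [mem_closedBall, dist_zero_right] at this
            have e : ‖x‖ ≤ ‖x + v‖ + ‖v‖ := by
              calc ‖x‖ = ‖(x + v) - v‖ := by rw [add_sub_cancel_right]
                _ ≤ ‖x + v‖ + ‖v‖ := norm_sub_le _ _
            linarith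
        rw [Set.indicator_of_mem hmem, abs_mul]
        refine (mul_le_of_le_one_right (abs_nonneg _) (hG1 x p)).trans ?_
        have := hmod x (x + v) (by rw [dist_eq_norm, sub_add_cancel_left, norm_neg]; exact hvn)
        rw [Real.dist_eq] at this
        exact this.le
    have hVfin : volume (closedBall (0 : ℝ × EuclideanSpace ℝ (Fin 3)) (R₀ + 1)) < ∞ := measure_closedBall_lt_top
    calc |Φf p| = |2 * Φf p| / 2 := by rw [abs_mul, abs_two]; ring
      _ = |∫ x, (χ x - χ (x + v)) * G x p| / 2 := by rw [h2]
      _ ≤ (∫ x, (closedBall (0 : ℝ × EuclideanSpace ℝ (Fin 3)) (R₀ + 1)).indicator (fun _ => η) x) / 2 := by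
          gcongr
          exact abs_integral_le_integral_abs.trans
            (integral_mono_of_nonneg (Eventually.of_forall fun x => abs_nonneg _)
              ((integrable_indicator_iff measurableSet_closedBall).2 (integrableOn_const hVfin.ne))
              (Eventually.of_forall hpt))
      _ = η * V / 2 := by rw [integral_indicator_const _ measurableSet_closedBall, smul_eq_mul, hV, Measure.real, mul_comm]
  -- assembly
  have hV0 : 0 ≤ V := ENNReal.toReal_nonneg
  rw [(hasBasis_cocompact.tendsto_iff Metric.nhds_basis_ball)]
  intro ε hε
  -- parameters
  set η : ℝ := ε / (V + 1) with hη
  have hη0 : 0 < η := by positivity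
  have hηV : η * V / 2 < ε := by
    have h1 : η * V ≤ η * (V + 1) := by nlinarith
    have h2 : η * (V + 1) = ε := by rw [hη]; field_simp
    nlinarith
  obtain ⟨δ₀, hδ₀, hmod⟩ := Metric.uniformContinuous_iff.1 huc η hη0
  set δ : ℝ := min δ₀ 1 with hδ
  have hδpos : 0 < δ := lt_min hδ₀ one_pos
  have hmod' : ∀ x y, dist x y < δ → dist (χ x) (χ y) < η := fun x y h => hmod (h.trans_le (min_le_left _ _))
  set R : ℝ := Real.pi / δ with hR
  set E₁ : ℝ := I / (t₁ * ε) + I / ε + 1 with hE₁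
  have hE₁0 : 0 ≤ E₁ := by positivity
  refine ⟨Icc (-E₁) E₁ ×ˢ closedBall (0 : EuclideanSpace ℝ (Fin 3)) R, isCompact_Icc.prod (isCompact_closedBall _ _),
    fun p hp => ?_⟩
  rw [mem_ball_zero_iff, Real.norm_eq_abs]
  show |Φf p| < ε
  rw [Set.mem_compl_iff, Set.mem_prod, not_and_or, mem_Icc, not_and_or, not_le, not_le, mem_closedBall, dist_zero_right,
    not_le] at hp
  -- the elementary bound `exp(-s) I < ε` for `s` large
  have hexp : ∀ s : ℝ, 0 ≤ s → I < ε * (1 + s) → Real.exp (-s) * I < ε := by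
    intro s hs h
    have h1 : Real.exp (-s) ≤ 1 / (1 + s) := by
      rw [Real.exp_neg, one_div]
      exact inv_anti₀ (by positivity) (by linarith [Real.add_one_le_exp s])
    calc Real.exp (-s) * I ≤ 1 / (1 + s) * I := mul_le_mul_of_nonneg_right h1 hI0
      _ < ε := by rw [div_mul_eq_mul_div, one_mul, div_lt_iff₀ (by positivity)]; exact h
  rcases hp with (h | h) | h
  · -- `E < -E₁`
    refine (hE p).trans_lt ?_
    have hneg : p.1 ≤ 0 := by linarith
    rw [min_eq_left hneg, max_eq_right hneg, mul_zero, sub_zero, show p.1 = -(-p.1) by ring]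
    refine hexp (-p.1) (by linarith) ?_
    have : I / ε < -p.1 := by linarith [show I / (t₁ * ε) ≥ 0 by positivity]
    rw [div_lt_iff₀ hε] at this
    nlinarith
  · -- `E₁ < E`
    refine (hE p).trans_lt ?_
    have hpos : 0 ≤ p.1 := by linarith
    rw [min_eq_right hpos, max_eq_left hpos, zero_sub, show -(t₁ * p.1) = -(t₁ * p.1) from rfl]
    refine hexp (t₁ * p.1) (by positivity) ?_
    have : I / (t₁ * ε) < p.1 := by linarith [show I / ε ≥ 0 by positivity]
    rw [div_lt_iff₀ (by positivity)] at this
    nlinarith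
  · -- `R < ‖q‖`
    exact (hq η hη0 δ hδpos (min_le_right _ _) hmod' p h).trans_lt hηV

end Summit.QuantumFields.YangMills.Theorems.F4SubCurvatureDoorSubCurvatureKernelLFTest

end
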